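import Summits.QuantumFields.YangMills.Theorems.FluctuationComparisonRegPrIntLOrganTangentOneStepTransportUHOfPolymerTransportH
import Summits.QuantumFields.YangMills.Theorems.FluctuationComparisonRegPrIntLOrganTangentSliceOfTubeAnalytic
import HarnessLib

/-!
# Crux `FluctuationComparisonRegPrIntL` (stmt-QuantumFields-20520, rung R3), (C2) road: **POLYᵘ-H v0.1 ⟸ POLYᵘ-H v0.2a (TUBE CONCLUSION)** and hence
# **O1ᵘ-H v2.2 ⟸ POLYᵘ-H v0.2a** — the tube-currency edition of the (C2) SUM-letter row, knitted by ✓p827459 `sliceAnalytic_family` ∘ ✓p826594; DEF-FREE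

Cell `ym3-torus` (YM ladder rung R3 = continuum `SU(2)` Yang–Mills on the three-torus — a RUNG: NOT d = 4, NOT infinite volume, NOT a mass gap, NOT Clay).
LEAD-20520 width seat `ym-ust-20520-w3` (gen 28); `--kind proof --supports stmt-QuantumFields-20520 --as helper`, count-neutral, definition-free, default
heartbeats, `autoImplicit false`; no registry ∕ binder ∕ `Lines/` ∕ row edit (registry `Lines/semiclassical_s2beta.lean` 3732b7df UNTOUCHED).

WHAT THIS IS.  px19 g23's UV3-NODE §88 G-P6 (iii): the (C2) row's own `act X` letter should be TUBE-analytic ([Balaban1987RG1] (1.18): «analytic on the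
space U^c_j(X, α₀, α₁)» — the tree's `BalabanUVClass.CplxModel.cplxTube` ∕ `LocWitness.actC_analytic` spelling), the (β)-SLICE form being a restriction
corollary.  POLYᵘ-H v0.2a = POLYᵘ-H v0.1 (HOME `ym-ust-20520-w3/g28/POLY-H.text.w3g28.txt`, digest 4020c64b; = ✓p826594's `hP`) with (i) ONE more letter `δT > 0`
(the tube radius) in the `∃ (θ r δT Ctr C w₀ …)` head, (ii) the per-`j` radius condition `Real.exp (6 * (r * (θ_j∕4))) ≤ 1 + δT` (✓p827459's
hypothesis, VERBATIM), and (iii) the (β)-slice conjunct REPLACED by the three TUBE letters of ✓`sliceAnalytic_family` VERBATIM — `actC X` `AnalyticOnNhd` on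
`cplxTube δT U` at every `θ_j∕4`-window point `U`, agreement with `act X` on embedded reals in the tube, oscillation `≤ wt X` on the tube; seed (REAL
`HClauseSq` block at `Ts`), frame, budget, `c′∕a′∕w′`, locality, presentation identity and `‖·‖_κ`-norm BYTE-KEPT.  THE SEED STAYS REAL in v0.2a (so
the edition still feeds `stub_oneStepTransportUH` VERBATIM); the tube-SEED edition v0.2b needs a tube-currency `RunPairSeed` upstream (LEAD №15
«TN-SEED-PROVENANCE», px19 g23 15:27Z sharpening) and is NOT typed here.
* ★★`polymerTransportH_of_tube` — POLYᵘ-H v0.1's text ⟸ POLYᵘ-H v0.2a's text (thread; `sliceAnalytic_family` with `good := PlaqSmall (θ_j∕4)`,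
  `ρ := r·(θ_j∕4)`, `.differentiableOn` on the `AnalyticOnNhd` letter).
* ★★★`oneStepTransportUH_of_polymerTransportH_tube` — O1ᵘ-H v2.2 VERBATIM ⟸ POLYᵘ-H v0.2a (✓p826594 ∘ ★★).
INHABITATION (★★OWNER RULING №100): LAW-FREE — `actC X` = the complex extension of a localised piece of the two-run difference of effective actions at
height `j` (own analyticity on the tube, [Balaban1987RG1] (1.18)); no fibre law, no score, no cross-law object.
HONEST FRAMING: a junction over ONE HYPOTHESIS schema; v0.2a is EXACTLY AS OPEN as O1ᵘ-H; under LEAD RULING №56 (FL-36c class 0) the covariant organ is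
the road OF RECORD and this (C2) edition is the SECOND typed road, not of record; nothing of Bałaban's analysis is asserted or proved; rows UNDISCHARGED;
S1aᴴ, S2α′, S2β, 26243, the five registered stubs, crux 20520 `FluctuationComparisonRegPrIntL` ∕ `YM3TorusSU2` NOT proved; no summit ∕ sub-problem statement
is proved by a helper; rung R3 = SU(2) YM₃ on T³ at fixed lattice data — NOT d = 4, NOT infinite volume, NOT a mass gap, NOT Clay; the Yang–Mills mass gap
is NOT proved.  [folklore] threading.  Credit: px19 g23 (§88, ✓p827459), desk g46∕g47, w4 g25.
-/

set_option autoImplicit false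

noncomputable section

open scoped Matrix.Norms.L2Operator

namespace Summit.QuantumFields.YangMills.Theorems.OrganTangentOneStepTransportUHOfPolymerTransportHTube

open MeasureTheory Filter Topology Function Metric Set
open scoped ENNReal BigOperators
open Literature.MathematicalPhysics.QuantumFieldTheory.Balaban1983to89 T3ContinuumYM3Torus T3NestedUnitLaws
  T3UnitLawDensityEML T4Continuum BalabanUVClass T3UnitScaleTilt T3LevelShift T3TiltDescent
open T4CubeChartExp (expPt)
open Summit.QuantumFields.YangMills.Theorems.OrganTangentSliceOfTubeAnalytic (sliceAnalytic_family)

/-- ★★ **POLYᵘ-H v0.1 ⟸ POLYᵘ-H v0.2a (tube conclusion)**: thread the heads (drop `δT`), the frame, the real seed and the output letters; replace the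
three tube letters by the (β)-slice conjunct via ✓`sliceAnalytic_family` (`good := PlaqSmall (θ_j∕4)`, `ρ := r·(θ_j∕4)`).  A junction over HYPOTHESIS
texts; nothing of Bałaban's is proved. [cite: Balaban1987RG1, (1.18) p.263; Balaban1985UV3, p.263] -/
theorem polymerTransportH_of_tube
    (hT : ∃ pW : ℝ, ∃ γ₁ : ℝ, 0 < γ₁ ∧ ∀ (F : T3Family) (γ : ℝ), 0 < γ → γ ≤ γ₁ → ∀ (b₀ p₀ : ℝ) (j₀ : ℕ) (prm : ℕ → ClassParams) (η : ℕ → ℝ) (rA : ℝ) (Bρ : ℕ → ℝ), 0 < b₀ → 0 < p₀ → pW ≤ p₀ → AdmissibleClassParams F γ b₀ p₀ prm → (∀ j, 0 ≤ η j) → Summable η → Summable (fun i => ∑' k, η (k + i)) → Tendsto (fun j => (∑' k, η (k + j)) * ((1 + 2 * ((F.L : ℝ) ^ j / γ) * (Fintype.card (Plaq (F.P j) 0) : ℝ)) * (Fintype.card (PBond (F.P j) 0) : ℝ) ^ 2)) atTop (𝓝 0) → 0 < rA → ∃ κ₀ : ℝ, 0 < κ₀ ∧ ∀ (κ : ℝ),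 0 < κ → κ ≤ κ₀ → ∃ (θ r δT Ctr C w₀ : ℝ) (εd δ : ℕ → ℝ) (j₁ : ℕ), 0 < θ ∧ 0 < r ∧ 0 < δT ∧ 1 ≤ Ctr ∧ 0 ≤ C ∧ 0 < w₀ ∧ (∀ j, 0 ≤ εd j ∧ 0 ≤ δ j) ∧ Summable εd ∧ Summable δ ∧ Summable (fun i => ∑' k, δ (k + i)) ∧ Tendsto (fun j => (∑' k, δ (k + j)) * ((1 + 2 * ((F.L : ℝ) ^ j / γ) * (Fintype.card (Plaq (F.P j) 0) : ℝ)) * (Fintype.card (PBond (F.P j) 0) : ℝ) ^ 2)) atTop (𝓝 0) ∧ j₀ ≤ j₁ ∧ ∀ (ν : ℕ → (j : ℕ) → MeasureTheory.Measure (GaugeField (F.P j) 0 ↥(Matrix.specialUnitaryGroup (Fin 2) ℂ))), (∀ K, ν K K = T4GenFunBounds.gibbsMeasure (F.P K) ((F.scheme ℰp γ).β K)) → (∀ K j, j < K → ν K j = Measure.map (descend F ℰp j) (ν K (j + 1))) → ∀ (K K' : ℕ), K ≤ K' → ∀ (Ts T : ℕ), Ts < T → T ≤ K → ∀ (μ μ'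 : ((j : ℕ) → MeasureTheory.Measure (GaugeField (F.P j) 0 ↥(Matrix.specialUnitaryGroup (Fin 2) ℂ)))) (ρ ρ' : ((j : ℕ) → GaugeField (F.P j) 0 ↥(Matrix.specialUnitaryGroup (Fin 2) ℂ) → ℝ)), (∀ j : ℕ, Ts ≤ j → j ≤ T → μ j = ν K j ∧ μ' j = ν K' j) → (∀ j : ℕ, j < Ts → μ j = Measure.map (descend F ℰp j) ((μ (j + 1)).withDensity (fun U => ENNReal.ofReal ((∏ p : Plaq _ _, max 0 (min 1 ((24 / 25 * (θBal F.L γ b₀ p₀ (j + 1)) - dist1 (GaugeField.plaqHol U p)) / ((24 / 25 - 1 / 2) * (θBal F.L γ b₀ p₀ (j + 1))))))))) ∧ μ' j = Measure.map (descend F ℰp j) ((μ' (j + 1)).withDensity (fun U => ENNReal.ofReal ((∏ p : Plaq _ _, max 0 (min 1 ((24 / 25 * (θBal F.L γ b₀ p₀ (j + 1)) - dist1 (GaugeField.plaqHol U p)) / ((24 / 25 - 1 / 2) * (θBal F.L γ b₀ p₀ (j + 1)))))))))) → (∀ j : ℕ, Ts ≤ j → j < T → μ j = Measure.map (descend F ℰp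 j) (μ (j + 1)) ∧ μ' j = Measure.map (descend F ℰp j) (μ' (j + 1))) → (∀ j : ℕ, j ≤ T → IsFiniteMeasure (μ j) ∧ IsFiniteMeasure (μ' j)) → (∀ j : ℕ, j₀ ≤ j → j ≤ T → ((∀ U, PlaqSmall (θBal F.L γ b₀ p₀ j) U → 0 < ρ j U ∧ 0 < ρ' j U) ∧ μ j = (fieldMeasure _ _ _).withDensity (fun U => ENNReal.ofReal (ρ j U)) ∧ μ' j = (fieldMeasure _ _ _).withDensity (fun U => ENNReal.ofReal (ρ' j U)) ∧ (∃ κ : ℝ, MemAtHeight F ℰp j (prm j) (fun U => Real.exp κ * ρ j U)) ∧ (∃ κ : ℝ, MemAtHeight F ℰp j (prm j) (fun U => Real.exp κ * ρ' j U)) ∧ μ j {U | ¬ PlaqSmall (θBal F.L γ b₀ p₀ j) U} ≤ ENNReal.ofReal (η j) ∧ μ' j {U | ¬ PlaqSmall (θBal F.L γ b₀ p₀ j) U} ≤ ENNReal.ofReal (η j) ∧ (ContinuousOn (ρ j) {U | PlaqSmall (θBal F.L γ b₀ p₀ j) U} ∧ ContinuousOn (ρ' j) {U | PlaqSmall (θBal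 F.L γ b₀ p₀ j) U}) ∧ ((∀ (U : GaugeField _ _ ↥(Matrix.specialUnitaryGroup (Fin 2) ℂ)), PlaqSmall (49 / 50 * θBal F.L γ b₀ p₀ j) U → ∀ (b b' : PBond _ _) (v v' : Fin 3 → ℝ), ‖v‖ ≤ 1 → ‖v'‖ ≤ 1 → ∃ g : ℂ × ℂ → ℂ, DifferentiableOn ℂ g (Metric.ball (0 : ℂ) (rA * (49 / 50 * θBal F.L γ b₀ p₀ j)) ×ˢ Metric.ball (0 : ℂ) (rA * (49 / 50 * θBal F.L γ b₀ p₀ j))) ∧ (∀ (s t : ℝ) (V Z : GaugeField _ _ ↥(Matrix.specialUnitaryGroup (Fin 2) ℂ)), |s| < rA * (49 / 50 * θBal F.L γ b₀ p₀ j) → |t| < rA * (49 / 50 * θBal F.L γ b₀ p₀ j) → (∀ e, e ≠ b → V e = U e) → V b = U b * expPt (s • v) → (∀ e, e ≠ b' → Z e = V e) → Z b' = V b' * expPt (t • v') → g ((s : ℂ), (t : ℂ)) = (((Real.log (ρ j Z)) : ℝ) : ℂ)) ∧ ∀ z ∈ Metric.ball (0 : ℂ) (rA * (49 / 50 * θBal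 F.L γ b₀ p₀ j)) ×ˢ Metric.ball (0 : ℂ) (rA * (49 / 50 * θBal F.L γ b₀ p₀ j)), ‖g z - g 0‖ ≤ (Bρ j)) ∧ (∀ (U : GaugeField _ _ ↥(Matrix.specialUnitaryGroup (Fin 2) ℂ)), PlaqSmall (49 / 50 * θBal F.L γ b₀ p₀ j) U → ∀ (b b' : PBond _ _) (v v' : Fin 3 → ℝ), ‖v‖ ≤ 1 → ‖v'‖ ≤ 1 → ∃ g : ℂ × ℂ → ℂ, DifferentiableOn ℂ g (Metric.ball (0 : ℂ) (rA * (49 / 50 * θBal F.L γ b₀ p₀ j)) ×ˢ Metric.ball (0 : ℂ) (rA * (49 / 50 * θBal F.L γ b₀ p₀ j))) ∧ (∀ (s t : ℝ) (V Z : GaugeField _ _ ↥(Matrix.specialUnitaryGroup (Fin 2) ℂ)), |s| < rA * (49 / 50 * θBal F.L γ b₀ p₀ j) → |t| < rA * (49 / 50 * θBal F.L γ b₀ p₀ j) → (∀ e, e ≠ b → V e = U e) → V b = U b * expPt (s • v) → (∀ e, e ≠ b' → Z e = V e) → Z b' = V b' * expPt (t • v') → g ((s : ℂ), (t : ℂ))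 = (((Real.log (ρ' j Z)) : ℝ) : ℂ)) ∧ ∀ z ∈ Metric.ball (0 : ℂ) (rA * (49 / 50 * θBal F.L γ b₀ p₀ j)) ×ˢ Metric.ball (0 : ℂ) (rA * (49 / 50 * θBal F.L γ b₀ p₀ j)), ‖g z - g 0‖ ≤ (Bρ j))))) → ∀ (w : ℝ), 0 ≤ w → w / (((F.L : ℝ) ^ Ts / γ) * θBal F.L γ b₀ p₀ Ts ^ 2) ≤ w₀ → (∃ k : PBond (F.P Ts) 0 → PBond (F.P Ts) 0 → ℝ, (∀ b b', 0 ≤ k b b') ∧ (∀ b, ∑ b', k b b' * Real.exp (κ * (b.src.tdist b'.src : ℝ)) ≤ w) ∧ (∀ (b b' : PBond _ _) (v v' : Fin 3 → ℝ) (U V W Z : GaugeField _ _ ↥(Matrix.specialUnitaryGroup (Fin 2) ℂ)), ‖v‖ ≤ (rA / 2) * (θBal F.L γ b₀ p₀ Ts / 4) → ‖v'‖ ≤ (rA / 2) * (θBal F.L γ b₀ p₀ Ts / 4) → PlaqSmall (θBal F.L γ b₀ p₀ Ts / 4) U → PlaqSmall (θBal F.L γ b₀ p₀ Ts / 4) V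 → PlaqSmall (θBal F.L γ b₀ p₀ Ts / 4) W → PlaqSmall (θBal F.L γ b₀ p₀ Ts / 4) Z → (∀ e, e ≠ b → V e = U e) → V b = U b * expPt v → (∀ e, e ≠ b' → W e = U e) → W b' = U b' * expPt v' → (∀ e, e ≠ b' → Z e = V e) → Z b' = V b' * expPt v' → |(Real.log (ρ Ts Z) - Real.log (ρ' Ts Z)) - (Real.log (ρ Ts V) - Real.log (ρ' Ts V)) - (Real.log (ρ Ts W) - Real.log (ρ' Ts W)) + (Real.log (ρ Ts U) - Real.log (ρ' Ts U))| ≤ k b b' * (‖v‖ / (θBal F.L γ b₀ p₀ Ts / 4)) * (‖v'‖ / (θBal F.L γ b₀ p₀ Ts / 4)))) → ∀ (j : ℕ), j₁ ≤ j → j + 1 ≤ Ts → ∃ (c' : Plaq (F.P j) 0 → ℝ) (a' w' : ℝ), 0 ≤ a' ∧ 0 ≤ w' ∧ a' + θ * (w' / (((F.L : ℝ) ^ j / γ) * θBal F.L γ b₀ p₀ j ^ 2)) ≤ (Ctr + εd (T - (Ts + 1)) + C * (w / (((F.L : ℝ) ^ Ts / γ) * θBal F.L γ b₀ p₀ Ts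 ^ 2))) * (w / (((F.L : ℝ) ^ Ts / γ) * θBal F.L γ b₀ p₀ Ts ^ 2)) + δ j ∧ (∀ p, |c' p| ≤ a') ∧ Real.exp (6 * (r * (θBal F.L γ b₀ p₀ j / 4))) ≤ 1 + δT ∧ ∃ (n : ℕ) (supp : Fin n → Finset (PBond (F.P j) 0)) (len wt : Fin n → ℝ) (act : Fin n → GaugeField (F.P j) 0 ↥(Matrix.specialUnitaryGroup (Fin 2) ℂ) → ℝ) (actC : Fin n → (PBond (F.P j) 0 → Matrix (Fin 2) (Fin 2) ℂ) → ℂ) (c₀ : ℝ), (∀ X, 0 ≤ wt X) ∧ (∀ X, ∀ e ∈ supp X, ∀ e' ∈ supp X, (e.src.tdist e'.src : ℝ) ≤ len X) ∧ (∀ X (U U' : GaugeField (F.P j) 0 ↥(Matrix.specialUnitaryGroup (Fin 2) ℂ)), (∀ e ∈ supp X, U e = U' e) → act X U = act X U') ∧ (∀ X (U : GaugeField (F.P j) 0 ↥(Matrix.specialUnitaryGroup (Fin 2) ℂ)), PlaqSmall (θBal F.L γ b₀ p₀ j / 4) U → AnalyticOnNhd ℂ (actC X) ((BalabanUVClass.CplxModel.specialUnitary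 (Fin 2)).cplxTube δT U)) ∧ (∀ X (U : GaugeField (F.P j) 0 ↥(Matrix.specialUnitaryGroup (Fin 2) ℂ)), PlaqSmall (θBal F.L γ b₀ p₀ j / 4) U → ∀ V : GaugeField (F.P j) 0 ↥(Matrix.specialUnitaryGroup (Fin 2) ℂ), (BalabanUVClass.CplxModel.specialUnitary (Fin 2)).embed V ∈ (BalabanUVClass.CplxModel.specialUnitary (Fin 2)).cplxTube δT U → actC X ((BalabanUVClass.CplxModel.specialUnitary (Fin 2)).embed V) = ((act X V : ℝ) : ℂ)) ∧ (∀ X (U : GaugeField (F.P j) 0 ↥(Matrix.specialUnitaryGroup (Fin 2) ℂ)), PlaqSmall (θBal F.L γ b₀ p₀ j / 4) U → ∀ W ∈ (BalabanUVClass.CplxModel.specialUnitary (Fin 2)).cplxTube δT U, ‖actC X W - actC X ((BalabanUVClass.CplxModel.specialUnitary (Fin 2)).embed U)‖ ≤ wt X) ∧ (∀ U : GaugeField (F.P j) 0 ↥(Matrix.specialUnitaryGroup (Fin 2) ℂ), PlaqSmall (θBal F.L γ b₀ p₀ j / 4) U → Real.log (ρ j U) - Real.log (ρ' j U) - ((F.L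 : ℝ) ^ j / γ) * ∑ p, c' p * (1 - reTr (GaugeField.plaqHol U p)) = c₀ + ∑ X, act X U) ∧ (∀ b : PBond (F.P j) 0, ∑ X ∈ Finset.univ.filter (fun X => b ∈ supp X), (8 * wt X / r ^ 2) * ((supp X).card : ℝ) * Real.exp (κ * len X) ≤ w')) :
    ∃ pW : ℝ, ∃ γ₁ : ℝ, 0 < γ₁ ∧ ∀ (F : T3Family) (γ : ℝ), 0 < γ → γ ≤ γ₁ → ∀ (b₀ p₀ : ℝ) (j₀ : ℕ) (prm : ℕ → ClassParams) (η : ℕ → ℝ) (rA : ℝ) (Bρ : ℕ → ℝ), 0 < b₀ → 0 < p₀ → pW ≤ p₀ → AdmissibleClassParams F γ b₀ p₀ prm → (∀ j, 0 ≤ η j) → Summable η → Summable (fun i => ∑' k, η (k + i)) → Tendsto (fun j => (∑' k, η (k + j)) * ((1 + 2 * ((F.L : ℝ) ^ j / γ) * (Fintype.card (Plaq (F.P j) 0) : ℝ)) * (Fintype.card (PBond (F.P j) 0) : ℝ) ^ 2)) atTop (𝓝 0) → 0 < rA → ∃ κ₀ : ℝ, 0 < κ₀ ∧ ∀ (κ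 : ℝ), 0 < κ → κ ≤ κ₀ → ∃ (θ r Ctr C w₀ : ℝ) (εd δ : ℕ → ℝ) (j₁ : ℕ), 0 < θ ∧ 0 < r ∧ 1 ≤ Ctr ∧ 0 ≤ C ∧ 0 < w₀ ∧ (∀ j, 0 ≤ εd j ∧ 0 ≤ δ j) ∧ Summable εd ∧ Summable δ ∧ Summable (fun i => ∑' k, δ (k + i)) ∧ Tendsto (fun j => (∑' k, δ (k + j)) * ((1 + 2 * ((F.L : ℝ) ^ j / γ) * (Fintype.card (Plaq (F.P j) 0) : ℝ)) * (Fintype.card (PBond (F.P j) 0) : ℝ) ^ 2)) atTop (𝓝 0) ∧ j₀ ≤ j₁ ∧ ∀ (ν : ℕ → (j : ℕ) → MeasureTheory.Measure (GaugeField (F.P j) 0 ↥(Matrix.specialUnitaryGroup (Fin 2) ℂ))), (∀ K, ν K K = T4GenFunBounds.gibbsMeasure (F.P K) ((F.scheme ℰp γ).β K)) → (∀ K j, j < K → ν K j = Measure.map (descend F ℰp j) (ν K (j + 1))) → ∀ (K K' : ℕ), K ≤ K' → ∀ (Ts T : ℕ), Ts < T → T ≤ K → ∀ (μ μ' : ((j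 : ℕ) → MeasureTheory.Measure (GaugeField (F.P j) 0 ↥(Matrix.specialUnitaryGroup (Fin 2) ℂ)))) (ρ ρ' : ((j : ℕ) → GaugeField (F.P j) 0 ↥(Matrix.specialUnitaryGroup (Fin 2) ℂ) → ℝ)), (∀ j : ℕ, Ts ≤ j → j ≤ T → μ j = ν K j ∧ μ' j = ν K' j) → (∀ j : ℕ, j < Ts → μ j = Measure.map (descend F ℰp j) ((μ (j + 1)).withDensity (fun U => ENNReal.ofReal ((∏ p : Plaq _ _, max 0 (min 1 ((24 / 25 * (θBal F.L γ b₀ p₀ (j + 1)) - dist1 (GaugeField.plaqHol U p)) / ((24 / 25 - 1 / 2) * (θBal F.L γ b₀ p₀ (j + 1))))))))) ∧ μ' j = Measure.map (descend F ℰp j) ((μ' (j + 1)).withDensity (fun U => ENNReal.ofReal ((∏ p : Plaq _ _, max 0 (min 1 ((24 / 25 * (θBal F.L γ b₀ p₀ (j + 1)) - dist1 (GaugeField.plaqHol U p)) / ((24 / 25 - 1 / 2) * (θBal F.L γ b₀ p₀ (j + 1)))))))))) → (∀ j : ℕ, Ts ≤ j → j < T → μ j = Measure.map (descend F ℰp j)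 (μ (j + 1)) ∧ μ' j = Measure.map (descend F ℰp j) (μ' (j + 1))) → (∀ j : ℕ, j ≤ T → IsFiniteMeasure (μ j) ∧ IsFiniteMeasure (μ' j)) → (∀ j : ℕ, j₀ ≤ j → j ≤ T → ((∀ U, PlaqSmall (θBal F.L γ b₀ p₀ j) U → 0 < ρ j U ∧ 0 < ρ' j U) ∧ μ j = (fieldMeasure _ _ _).withDensity (fun U => ENNReal.ofReal (ρ j U)) ∧ μ' j = (fieldMeasure _ _ _).withDensity (fun U => ENNReal.ofReal (ρ' j U)) ∧ (∃ κ : ℝ, MemAtHeight F ℰp j (prm j) (fun U => Real.exp κ * ρ j U)) ∧ (∃ κ : ℝ, MemAtHeight F ℰp j (prm j) (fun U => Real.exp κ * ρ' j U)) ∧ μ j {U | ¬ PlaqSmall (θBal F.L γ b₀ p₀ j) U} ≤ ENNReal.ofReal (η j) ∧ μ' j {U | ¬ PlaqSmall (θBal F.L γ b₀ p₀ j) U} ≤ ENNReal.ofReal (η j) ∧ (ContinuousOn (ρ j) {U | PlaqSmall (θBal F.L γ b₀ p₀ j) U} ∧ ContinuousOn (ρ' j) {U | PlaqSmall (θBal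 F.L γ b₀ p₀ j) U}) ∧ ((∀ (U : GaugeField _ _ ↥(Matrix.specialUnitaryGroup (Fin 2) ℂ)), PlaqSmall (49 / 50 * θBal F.L γ b₀ p₀ j) U → ∀ (b b' : PBond _ _) (v v' : Fin 3 → ℝ), ‖v‖ ≤ 1 → ‖v'‖ ≤ 1 → ∃ g : ℂ × ℂ → ℂ, DifferentiableOn ℂ g (Metric.ball (0 : ℂ) (rA * (49 / 50 * θBal F.L γ b₀ p₀ j)) ×ˢ Metric.ball (0 : ℂ) (rA * (49 / 50 * θBal F.L γ b₀ p₀ j))) ∧ (∀ (s t : ℝ) (V Z : GaugeField _ _ ↥(Matrix.specialUnitaryGroup (Fin 2) ℂ)), |s| < rA * (49 / 50 * θBal F.L γ b₀ p₀ j) → |t| < rA * (49 / 50 * θBal F.L γ b₀ p₀ j) → (∀ e, e ≠ b → V e = U e) → V b = U b * expPt (s • v) → (∀ e, e ≠ b' → Z e = V e) → Z b' = V b' * expPt (t • v') → g ((s : ℂ), (t : ℂ)) = (((Real.log (ρ j Z)) : ℝ) : ℂ)) ∧ ∀ z ∈ Metric.ball (0 : ℂ) (rA * (49 / 50 * θBal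 F.L γ b₀ p₀ j)) ×ˢ Metric.ball (0 : ℂ) (rA * (49 / 50 * θBal F.L γ b₀ p₀ j)), ‖g z - g 0‖ ≤ (Bρ j)) ∧ (∀ (U : GaugeField _ _ ↥(Matrix.specialUnitaryGroup (Fin 2) ℂ)), PlaqSmall (49 / 50 * θBal F.L γ b₀ p₀ j) U → ∀ (b b' : PBond _ _) (v v' : Fin 3 → ℝ), ‖v‖ ≤ 1 → ‖v'‖ ≤ 1 → ∃ g : ℂ × ℂ → ℂ, DifferentiableOn ℂ g (Metric.ball (0 : ℂ) (rA * (49 / 50 * θBal F.L γ b₀ p₀ j)) ×ˢ Metric.ball (0 : ℂ) (rA * (49 / 50 * θBal F.L γ b₀ p₀ j))) ∧ (∀ (s t : ℝ) (V Z : GaugeField _ _ ↥(Matrix.specialUnitaryGroup (Fin 2) ℂ)), |s| < rA * (49 / 50 * θBal F.L γ b₀ p₀ j) → |t| < rA * (49 / 50 * θBal F.L γ b₀ p₀ j) → (∀ e, e ≠ b → V e = U e) → V b = U b * expPt (s • v) → (∀ e, e ≠ b' → Z e = V e) → Z b' = V b' * expPt (t • v') → g ((s : ℂ), (t : ℂ))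 = (((Real.log (ρ' j Z)) : ℝ) : ℂ)) ∧ ∀ z ∈ Metric.ball (0 : ℂ) (rA * (49 / 50 * θBal F.L γ b₀ p₀ j)) ×ˢ Metric.ball (0 : ℂ) (rA * (49 / 50 * θBal F.L γ b₀ p₀ j)), ‖g z - g 0‖ ≤ (Bρ j))))) → ∀ (w : ℝ), 0 ≤ w → w / (((F.L : ℝ) ^ Ts / γ) * θBal F.L γ b₀ p₀ Ts ^ 2) ≤ w₀ → (∃ k : PBond (F.P Ts) 0 → PBond (F.P Ts) 0 → ℝ, (∀ b b', 0 ≤ k b b') ∧ (∀ b, ∑ b', k b b' * Real.exp (κ * (b.src.tdist b'.src : ℝ)) ≤ w) ∧ (∀ (b b' : PBond _ _) (v v' : Fin 3 → ℝ) (U V W Z : GaugeField _ _ ↥(Matrix.specialUnitaryGroup (Fin 2) ℂ)), ‖v‖ ≤ (rA / 2) * (θBal F.L γ b₀ p₀ Ts / 4) → ‖v'‖ ≤ (rA / 2) * (θBal F.L γ b₀ p₀ Ts / 4) → PlaqSmall (θBal F.L γ b₀ p₀ Ts / 4) U → PlaqSmall (θBal F.L γ b₀ p₀ Ts / 4) V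 → PlaqSmall (θBal F.L γ b₀ p₀ Ts / 4) W → PlaqSmall (θBal F.L γ b₀ p₀ Ts / 4) Z → (∀ e, e ≠ b → V e = U e) → V b = U b * expPt v → (∀ e, e ≠ b' → W e = U e) → W b' = U b' * expPt v' → (∀ e, e ≠ b' → Z e = V e) → Z b' = V b' * expPt v' → |(Real.log (ρ Ts Z) - Real.log (ρ' Ts Z)) - (Real.log (ρ Ts V) - Real.log (ρ' Ts V)) - (Real.log (ρ Ts W) - Real.log (ρ' Ts W)) + (Real.log (ρ Ts U) - Real.log (ρ' Ts U))| ≤ k b b' * (‖v‖ / (θBal F.L γ b₀ p₀ Ts / 4)) * (‖v'‖ / (θBal F.L γ b₀ p₀ Ts / 4)))) → ∀ (j : ℕ), j₁ ≤ j → j + 1 ≤ Ts → ∃ (c' : Plaq (F.P j) 0 → ℝ) (a' w' : ℝ), 0 ≤ a' ∧ 0 ≤ w' ∧ a' + θ * (w' / (((F.L : ℝ) ^ j / γ) * θBal F.L γ b₀ p₀ j ^ 2)) ≤ (Ctr + εd (T - (Ts + 1)) + C * (w / (((F.L : ℝ) ^ Ts / γ) * θBal F.L γ b₀ p₀ Ts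 ^ 2))) * (w / (((F.L : ℝ) ^ Ts / γ) * θBal F.L γ b₀ p₀ Ts ^ 2)) + δ j ∧ (∀ p, |c' p| ≤ a') ∧ ∃ (n : ℕ) (supp : Fin n → Finset (PBond (F.P j) 0)) (len wt : Fin n → ℝ) (act : Fin n → GaugeField (F.P j) 0 ↥(Matrix.specialUnitaryGroup (Fin 2) ℂ) → ℝ) (c₀ : ℝ), (∀ X, 0 ≤ wt X) ∧ (∀ X, ∀ e ∈ supp X, ∀ e' ∈ supp X, (e.src.tdist e'.src : ℝ) ≤ len X) ∧ (∀ X (U U' : GaugeField (F.P j) 0 ↥(Matrix.specialUnitaryGroup (Fin 2) ℂ)), (∀ e ∈ supp X, U e = U' e) → act X U = act X U') ∧ (∀ X (U : GaugeField (F.P j) 0 ↥(Matrix.specialUnitaryGroup (Fin 2) ℂ)), PlaqSmall (θBal F.L γ b₀ p₀ j / 4) U → ∀ (b b' : PBond (F.P j) 0) (w₁ w₁' : Fin 3 → ℝ), ‖w₁‖ ≤ 1 → ‖w₁'‖ ≤ 1 → ∃ g : ℂ × ℂ → ℂ, DifferentiableOn ℂ g (Metric.ball (0 : ℂ) (r *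 (θBal F.L γ b₀ p₀ j / 4)) ×ˢ Metric.ball (0 : ℂ) (r * (θBal F.L γ b₀ p₀ j / 4))) ∧ (∀ (s t : ℝ) (V Z : GaugeField (F.P j) 0 ↥(Matrix.specialUnitaryGroup (Fin 2) ℂ)), |s| < r * (θBal F.L γ b₀ p₀ j / 4) → |t| < r * (θBal F.L γ b₀ p₀ j / 4) → (∀ e, e ≠ b → V e = U e) → V b = U b * expPt (s • w₁) → (∀ e, e ≠ b' → Z e = V e) → Z b' = V b' * expPt (t • w₁') → g ((s : ℂ), (t : ℂ)) = ((act X Z : ℝ) : ℂ)) ∧ ∀ z ∈ Metric.ball (0 : ℂ) (r * (θBal F.L γ b₀ p₀ j / 4)) ×ˢ Metric.ball (0 : ℂ) (r * (θBal F.L γ b₀ p₀ j / 4)), ‖g z - g 0‖ ≤ wt X) ∧ (∀ U : GaugeField (F.P j) 0 ↥(Matrix.specialUnitaryGroup (Fin 2) ℂ), PlaqSmall (θBal F.L γ b₀ p₀ j / 4) U → Real.log (ρ j U) - Real.log (ρ' j U) - ((F.L : ℝ) ^ j / γ) * ∑ p, c' p * (1 - reTr (GaugeField.plaqHol U p)) =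 c₀ + ∑ X, act X U) ∧ (∀ b : PBond (F.P j) 0, ∑ X ∈ Finset.univ.filter (fun X => b ∈ supp X), (8 * wt X / r ^ 2) * ((supp X).card : ℝ) * Real.exp (κ * len X) ≤ w') := by
  obtain ⟨pW, γ₁, hγ₁, hT⟩ := hT
  refine ⟨pW, γ₁, hγ₁, ?_⟩
  intro F γ hγ hγle b₀ p₀ j₀ prm η rA Bρ hb₀ hp₀ hpW hadm hη0 hηs hηss hηt hrA
  obtain ⟨κ₀, hκ₀, hT⟩ := hT F γ hγ hγle b₀ p₀ j₀ prm η rA Bρ hb₀ hp₀ hpW hadm hη0 hηs hηss hηt hrA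
  refine ⟨κ₀, hκ₀, fun κ hκ hκle => ?_⟩
  obtain ⟨θ, r, δT, Ctr, C, w₀, εd, δ, j₁, hθ, hr, hδT, hCtr, hC, hw₀, hεδ, hεds, hδs, hδss, hδt, hj₀₁, hT⟩ := hT κ hκ hκle
  refine ⟨θ, r, Ctr, C, w₀, εd, δ, j₁, hθ, hr, hCtr, hC, hw₀, hεδ, hεds, hδs, hδss, hδt, hj₀₁, ?_⟩
  intro ν hG hCν K K' hKK' Ts T hTs hTK μ μ' ρ ρ' hanch hcut hcons hfin hwin w hw0 hwle hseed j hj₁ hjTs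
  obtain ⟨c', a', w', ha', hw', hbudget, hc', hrad, n, supp, len, wt, act, actC, c₀, hwt, hdiam, hloc, hA, hagree, hosc, hpres, hnorm⟩ :=
    hT ν hG hCν K K' hKK' Ts T hTs hTK μ μ' ρ ρ' hanch hcut hcons hfin hwin w hw0 hwle hseed j hj₁ hjTs
  refine ⟨c', a', w', ha', hw', hbudget, hc', n, supp, len, wt, act, c₀, hwt, hdiam, hloc, ?_, hpres, hnorm⟩
  classical
  exact sliceAnalytic_family (good := fun U => PlaqSmall (θBal F.L γ b₀ p₀ j / 4) U) hrad actC act wt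
    (fun X U hU => (hA X U hU).differentiableOn) (fun X U hU => hagree X U hU) (fun X U hU => hosc X U hU)

/-- ★★★ **O1ᵘ-H v2.2 ⟸ POLYᵘ-H v0.2a (tube conclusion)** = ✓p826594 ∘ ★★`polymerTransportH_of_tube`; conclusion = O1ᵘ-H v2.2 VERBATIM.  Nothing of
Bałaban's is proved. [cite: Balaban1987RG1, Thm 1 (0.22)-(0.30) pp.256-258, (1.18) p.263; Balaban1985UV3, p.263] -/
theorem oneStepTransportUH_of_polymerTransportH_tube
    (hT : ∃ pW : ℝ, ∃ γ₁ : ℝ, 0 < γ₁ ∧ ∀ (F : T3Family) (γ : ℝ), 0 < γ → γ ≤ γ₁ → ∀ (b₀ p₀ : ℝ) (j₀ : ℕ) (prm : ℕ → ClassParams) (η : ℕ → ℝ) (rA : ℝ) (Bρ : ℕ → ℝ), 0 < b₀ → 0 < p₀ → pW ≤ p₀ → AdmissibleClassParams F γ b₀ p₀ prm → (∀ j, 0 ≤ η j) → Summable η → Summable (fun i => ∑' k, η (k + i)) → Tendsto (fun j => (∑' k, η (k + j)) * ((1 + 2 * ((F.L : ℝ) ^ j / γ) * (Fintype.card (Plaq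 (F.P j) 0) : ℝ)) * (Fintype.card (PBond (F.P j) 0) : ℝ) ^ 2)) atTop (𝓝 0) → 0 < rA → ∃ κ₀ : ℝ, 0 < κ₀ ∧ ∀ (κ : ℝ), 0 < κ → κ ≤ κ₀ → ∃ (θ r δT Ctr C w₀ : ℝ) (εd δ : ℕ → ℝ) (j₁ : ℕ), 0 < θ ∧ 0 < r ∧ 0 < δT ∧ 1 ≤ Ctr ∧ 0 ≤ C ∧ 0 < w₀ ∧ (∀ j, 0 ≤ εd j ∧ 0 ≤ δ j) ∧ Summable εd ∧ Summable δ ∧ Summable (fun i => ∑' k, δ (k + i)) ∧ Tendsto (fun j => (∑' k, δ (k + j)) * ((1 + 2 * ((F.L : ℝ) ^ j / γ) * (Fintype.card (Plaq (F.P j) 0) : ℝ)) * (Fintype.card (PBond (F.P j) 0) : ℝ) ^ 2)) atTop (𝓝 0) ∧ j₀ ≤ j₁ ∧ ∀ (ν : ℕ → (j : ℕ) → MeasureTheory.Measure (GaugeField (F.P j) 0 ↥(Matrix.specialUnitaryGroup (Fin 2) ℂ))), (∀ K, ν K K = T4GenFunBounds.gibbsMeasure (F.P K) ((F.scheme ℰp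 γ).β K)) → (∀ K j, j < K → ν K j = Measure.map (descend F ℰp j) (ν K (j + 1))) → ∀ (K K' : ℕ), K ≤ K' → ∀ (Ts T : ℕ), Ts < T → T ≤ K → ∀ (μ μ' : ((j : ℕ) → MeasureTheory.Measure (GaugeField (F.P j) 0 ↥(Matrix.specialUnitaryGroup (Fin 2) ℂ)))) (ρ ρ' : ((j : ℕ) → GaugeField (F.P j) 0 ↥(Matrix.specialUnitaryGroup (Fin 2) ℂ) → ℝ)), (∀ j : ℕ, Ts ≤ j → j ≤ T → μ j = ν K j ∧ μ' j = ν K' j) → (∀ j : ℕ, j < Ts → μ j = Measure.map (descend F ℰp j) ((μ (j + 1)).withDensity (fun U => ENNReal.ofReal ((∏ p : Plaq _ _, max 0 (min 1 ((24 / 25 * (θBal F.L γ b₀ p₀ (j + 1)) - dist1 (GaugeField.plaqHol U p)) / ((24 / 25 - 1 / 2) * (θBal F.L γ b₀ p₀ (j + 1))))))))) ∧ μ' j = Measure.map (descend F ℰp j) ((μ' (j + 1)).withDensity (fun U => ENNReal.ofReal ((∏ p : Plaq _ _, max 0 (min 1 ((24 / 25 * (θBal F.L γ b₀ p₀ (j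 + 1)) - dist1 (GaugeField.plaqHol U p)) / ((24 / 25 - 1 / 2) * (θBal F.L γ b₀ p₀ (j + 1)))))))))) → (∀ j : ℕ, Ts ≤ j → j < T → μ j = Measure.map (descend F ℰp j) (μ (j + 1)) ∧ μ' j = Measure.map (descend F ℰp j) (μ' (j + 1))) → (∀ j : ℕ, j ≤ T → IsFiniteMeasure (μ j) ∧ IsFiniteMeasure (μ' j)) → (∀ j : ℕ, j₀ ≤ j → j ≤ T → ((∀ U, PlaqSmall (θBal F.L γ b₀ p₀ j) U → 0 < ρ j U ∧ 0 < ρ' j U) ∧ μ j = (fieldMeasure _ _ _).withDensity (fun U => ENNReal.ofReal (ρ j U)) ∧ μ' j = (fieldMeasure _ _ _).withDensity (fun U => ENNReal.ofReal (ρ' j U)) ∧ (∃ κ : ℝ, MemAtHeight F ℰp j (prm j) (fun U => Real.exp κ * ρ j U)) ∧ (∃ κ : ℝ, MemAtHeight F ℰp j (prm j) (fun U => Real.exp κ * ρ' j U)) ∧ μ j {U | ¬ PlaqSmall (θBal F.L γ b₀ p₀ j) U} ≤ ENNReal.ofReal (η j) ∧ μ' j {U | ¬ PlaqSmall (θBal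 F.L γ b₀ p₀ j) U} ≤ ENNReal.ofReal (η j) ∧ (ContinuousOn (ρ j) {U | PlaqSmall (θBal F.L γ b₀ p₀ j) U} ∧ ContinuousOn (ρ' j) {U | PlaqSmall (θBal F.L γ b₀ p₀ j) U}) ∧ ((∀ (U : GaugeField _ _ ↥(Matrix.specialUnitaryGroup (Fin 2) ℂ)), PlaqSmall (49 / 50 * θBal F.L γ b₀ p₀ j) U → ∀ (b b' : PBond _ _) (v v' : Fin 3 → ℝ), ‖v‖ ≤ 1 → ‖v'‖ ≤ 1 → ∃ g : ℂ × ℂ → ℂ, DifferentiableOn ℂ g (Metric.ball (0 : ℂ) (rA * (49 / 50 * θBal F.L γ b₀ p₀ j)) ×ˢ Metric.ball (0 : ℂ) (rA * (49 / 50 * θBal F.L γ b₀ p₀ j))) ∧ (∀ (s t : ℝ) (V Z : GaugeField _ _ ↥(Matrix.specialUnitaryGroup (Fin 2) ℂ)), |s| < rA * (49 / 50 * θBal F.L γ b₀ p₀ j) → |t| < rA * (49 / 50 * θBal F.L γ b₀ p₀ j) → (∀ e, e ≠ b → V e = U e) → V b = U b * expPt (s • v) → (∀ e, e ≠ b' →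 Z e = V e) → Z b' = V b' * expPt (t • v') → g ((s : ℂ), (t : ℂ)) = (((Real.log (ρ j Z)) : ℝ) : ℂ)) ∧ ∀ z ∈ Metric.ball (0 : ℂ) (rA * (49 / 50 * θBal F.L γ b₀ p₀ j)) ×ˢ Metric.ball (0 : ℂ) (rA * (49 / 50 * θBal F.L γ b₀ p₀ j)), ‖g z - g 0‖ ≤ (Bρ j)) ∧ (∀ (U : GaugeField _ _ ↥(Matrix.specialUnitaryGroup (Fin 2) ℂ)), PlaqSmall (49 / 50 * θBal F.L γ b₀ p₀ j) U → ∀ (b b' : PBond _ _) (v v' : Fin 3 → ℝ), ‖v‖ ≤ 1 → ‖v'‖ ≤ 1 → ∃ g : ℂ × ℂ → ℂ, DifferentiableOn ℂ g (Metric.ball (0 : ℂ) (rA * (49 / 50 * θBal F.L γ b₀ p₀ j)) ×ˢ Metric.ball (0 : ℂ) (rA * (49 / 50 * θBal F.L γ b₀ p₀ j))) ∧ (∀ (s t : ℝ) (V Z : GaugeField _ _ ↥(Matrix.specialUnitaryGroup (Fin 2) ℂ)), |s| < rA * (49 / 50 * θBal F.L γ b₀ p₀ j) → |t| < rA * (49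 / 50 * θBal F.L γ b₀ p₀ j) → (∀ e, e ≠ b → V e = U e) → V b = U b * expPt (s • v) → (∀ e, e ≠ b' → Z e = V e) → Z b' = V b' * expPt (t • v') → g ((s : ℂ), (t : ℂ)) = (((Real.log (ρ' j Z)) : ℝ) : ℂ)) ∧ ∀ z ∈ Metric.ball (0 : ℂ) (rA * (49 / 50 * θBal F.L γ b₀ p₀ j)) ×ˢ Metric.ball (0 : ℂ) (rA * (49 / 50 * θBal F.L γ b₀ p₀ j)), ‖g z - g 0‖ ≤ (Bρ j))))) → ∀ (w : ℝ), 0 ≤ w → w / (((F.L : ℝ) ^ Ts / γ) * θBal F.L γ b₀ p₀ Ts ^ 2) ≤ w₀ → (∃ k : PBond (F.P Ts) 0 → PBond (F.P Ts) 0 → ℝ, (∀ b b', 0 ≤ k b b') ∧ (∀ b, ∑ b', k b b' * Real.exp (κ * (b.src.tdist b'.src : ℝ)) ≤ w) ∧ (∀ (b b' : PBond _ _) (v v' : Fin 3 → ℝ) (U V W Z : GaugeField _ _ ↥(Matrix.specialUnitaryGroup (Fin 2) ℂ)), ‖v‖ ≤ (rA / 2) * (θBal F.L γ b₀ p₀ Ts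 / 4) → ‖v'‖ ≤ (rA / 2) * (θBal F.L γ b₀ p₀ Ts / 4) → PlaqSmall (θBal F.L γ b₀ p₀ Ts / 4) U → PlaqSmall (θBal F.L γ b₀ p₀ Ts / 4) V → PlaqSmall (θBal F.L γ b₀ p₀ Ts / 4) W → PlaqSmall (θBal F.L γ b₀ p₀ Ts / 4) Z → (∀ e, e ≠ b → V e = U e) → V b = U b * expPt v → (∀ e, e ≠ b' → W e = U e) → W b' = U b' * expPt v' → (∀ e, e ≠ b' → Z e = V e) → Z b' = V b' * expPt v' → |(Real.log (ρ Ts Z) - Real.log (ρ' Ts Z)) - (Real.log (ρ Ts V) - Real.log (ρ' Ts V)) - (Real.log (ρ Ts W) - Real.log (ρ' Ts W)) + (Real.log (ρ Ts U) - Real.log (ρ' Ts U))| ≤ k b b' * (‖v‖ / (θBal F.L γ b₀ p₀ Ts / 4)) * (‖v'‖ / (θBal F.L γ b₀ p₀ Ts / 4)))) → ∀ (j : ℕ), j₁ ≤ j → j + 1 ≤ Ts → ∃ (c' : Plaq (F.P j) 0 → ℝ) (a' w' : ℝ), 0 ≤ a' ∧ 0 ≤ w' ∧ a' + θ * (w'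 / (((F.L : ℝ) ^ j / γ) * θBal F.L γ b₀ p₀ j ^ 2)) ≤ (Ctr + εd (T - (Ts + 1)) + C * (w / (((F.L : ℝ) ^ Ts / γ) * θBal F.L γ b₀ p₀ Ts ^ 2))) * (w / (((F.L : ℝ) ^ Ts / γ) * θBal F.L γ b₀ p₀ Ts ^ 2)) + δ j ∧ (∀ p, |c' p| ≤ a') ∧ Real.exp (6 * (r * (θBal F.L γ b₀ p₀ j / 4))) ≤ 1 + δT ∧ ∃ (n : ℕ) (supp : Fin n → Finset (PBond (F.P j) 0)) (len wt : Fin n → ℝ) (act : Fin n → GaugeField (F.P j) 0 ↥(Matrix.specialUnitaryGroup (Fin 2) ℂ) → ℝ) (actC : Fin n → (PBond (F.P j) 0 → Matrix (Fin 2) (Fin 2) ℂ) → ℂ) (c₀ : ℝ), (∀ X, 0 ≤ wt X) ∧ (∀ X, ∀ e ∈ supp X, ∀ e' ∈ supp X, (e.src.tdist e'.src : ℝ) ≤ len X) ∧ (∀ X (U U' : GaugeField (F.P j) 0 ↥(Matrix.specialUnitaryGroup (Fin 2) ℂ)), (∀ e ∈ supp X, U e = U' e) → act X U = act X U') ∧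 (∀ X (U : GaugeField (F.P j) 0 ↥(Matrix.specialUnitaryGroup (Fin 2) ℂ)), PlaqSmall (θBal F.L γ b₀ p₀ j / 4) U → AnalyticOnNhd ℂ (actC X) ((BalabanUVClass.CplxModel.specialUnitary (Fin 2)).cplxTube δT U)) ∧ (∀ X (U : GaugeField (F.P j) 0 ↥(Matrix.specialUnitaryGroup (Fin 2) ℂ)), PlaqSmall (θBal F.L γ b₀ p₀ j / 4) U → ∀ V : GaugeField (F.P j) 0 ↥(Matrix.specialUnitaryGroup (Fin 2) ℂ), (BalabanUVClass.CplxModel.specialUnitary (Fin 2)).embed V ∈ (BalabanUVClass.CplxModel.specialUnitary (Fin 2)).cplxTube δT U → actC X ((BalabanUVClass.CplxModel.specialUnitary (Fin 2)).embed V) = ((act X V : ℝ) : ℂ)) ∧ (∀ X (U : GaugeField (F.P j) 0 ↥(Matrix.specialUnitaryGroup (Fin 2) ℂ)), PlaqSmall (θBal F.L γ b₀ p₀ j / 4) U → ∀ W ∈ (BalabanUVClass.CplxModel.specialUnitary (Fin 2)).cplxTube δT U, ‖actC X W - actC X ((BalabanUVClass.CplxModel.specialUnitary (Fin 2)).embed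 U)‖ ≤ wt X) ∧ (∀ U : GaugeField (F.P j) 0 ↥(Matrix.specialUnitaryGroup (Fin 2) ℂ), PlaqSmall (θBal F.L γ b₀ p₀ j / 4) U → Real.log (ρ j U) - Real.log (ρ' j U) - ((F.L : ℝ) ^ j / γ) * ∑ p, c' p * (1 - reTr (GaugeField.plaqHol U p)) = c₀ + ∑ X, act X U) ∧ (∀ b : PBond (F.P j) 0, ∑ X ∈ Finset.univ.filter (fun X => b ∈ supp X), (8 * wt X / r ^ 2) * ((supp X).card : ℝ) * Real.exp (κ * len X) ≤ w')) :
    ∃ pW : ℝ, ∃ γ₁ : ℝ, 0 < γ₁ ∧ ∀ (F : T3Family) (γ : ℝ), 0 < γ → γ ≤ γ₁ → ∀ (b₀ p₀ : ℝ) (j₀ : ℕ) (prm : ℕ → ClassParams) (η : ℕ → ℝ) (rA : ℝ) (Bρ : ℕ → ℝ), 0 < b₀ → 0 < p₀ → pW ≤ p₀ → AdmissibleClassParams F γ b₀ p₀ prm → (∀ j, 0 ≤ η j) → Summable η → Summable (fun i => ∑' k, η (k + i)) → Tendsto (fun j => (∑' k, η (k + j)) * ((1 + 2 * ((F.L : ℝ)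 ^ j / γ) * (Fintype.card (Plaq (F.P j) 0) : ℝ)) * (Fintype.card (PBond (F.P j) 0) : ℝ) ^ 2)) atTop (𝓝 0) → 0 < rA → ∃ κ₀ : ℝ, 0 < κ₀ ∧ ∀ (κ : ℝ), 0 < κ → κ ≤ κ₀ → ∃ (θ r Ctr C w₀ : ℝ) (εd δ : ℕ → ℝ) (j₁ : ℕ), 0 < θ ∧ 0 < r ∧ 1 ≤ Ctr ∧ 0 ≤ C ∧ 0 < w₀ ∧ (∀ j, 0 ≤ εd j ∧ 0 ≤ δ j) ∧ Summable εd ∧ Summable δ ∧ Summable (fun i => ∑' k, δ (k + i)) ∧ Tendsto (fun j => (∑' k, δ (k + j)) * ((1 + 2 * ((F.L : ℝ) ^ j / γ) * (Fintype.card (Plaq (F.P j) 0) : ℝ)) * (Fintype.card (PBond (F.P j) 0) : ℝ) ^ 2)) atTop (𝓝 0) ∧ j₀ ≤ j₁ ∧ ∀ (ν : ℕ → (j : ℕ) → MeasureTheory.Measure (GaugeField (F.P j) 0 ↥(Matrix.specialUnitaryGroup (Fin 2) ℂ))), (∀ K, ν K K = T4GenFunBounds.gibbsMeasure (F.P K)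 ((F.scheme ℰp γ).β K)) → (∀ K j, j < K → ν K j = Measure.map (descend F ℰp j) (ν K (j + 1))) → ∀ (K K' : ℕ), K ≤ K' → ∀ (Ts T : ℕ), Ts < T → T ≤ K → ∀ (μ μ' : ((j : ℕ) → MeasureTheory.Measure (GaugeField (F.P j) 0 ↥(Matrix.specialUnitaryGroup (Fin 2) ℂ)))) (ρ ρ' : ((j : ℕ) → GaugeField (F.P j) 0 ↥(Matrix.specialUnitaryGroup (Fin 2) ℂ) → ℝ)), (∀ j : ℕ, Ts ≤ j → j ≤ T → μ j = ν K j ∧ μ' j = ν K' j) → (∀ j : ℕ, j < Ts → μ j = Measure.map (descend F ℰp j) ((μ (j + 1)).withDensity (fun U => ENNReal.ofReal ((∏ p : Plaq _ _, max 0 (min 1 ((24 / 25 * (θBal F.L γ b₀ p₀ (j + 1)) - dist1 (GaugeField.plaqHol U p)) / ((24 / 25 - 1 / 2) * (θBal F.L γ b₀ p₀ (j + 1))))))))) ∧ μ' j = Measure.map (descend F ℰp j) ((μ' (j + 1)).withDensity (fun U => ENNReal.ofReal ((∏ p : Plaq _ _, max 0 (min 1 ((24 / 25 * (θBal F.L γ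 b₀ p₀ (j + 1)) - dist1 (GaugeField.plaqHol U p)) / ((24 / 25 - 1 / 2) * (θBal F.L γ b₀ p₀ (j + 1)))))))))) → (∀ j : ℕ, Ts ≤ j → j < T → μ j = Measure.map (descend F ℰp j) (μ (j + 1)) ∧ μ' j = Measure.map (descend F ℰp j) (μ' (j + 1))) → (∀ j : ℕ, j ≤ T → IsFiniteMeasure (μ j) ∧ IsFiniteMeasure (μ' j)) → (∀ j : ℕ, j₀ ≤ j → j ≤ T → ((∀ U, PlaqSmall (θBal F.L γ b₀ p₀ j) U → 0 < ρ j U ∧ 0 < ρ' j U) ∧ μ j = (fieldMeasure _ _ _).withDensity (fun U => ENNReal.ofReal (ρ j U)) ∧ μ' j = (fieldMeasure _ _ _).withDensity (fun U => ENNReal.ofReal (ρ' j U)) ∧ (∃ κ : ℝ, MemAtHeight F ℰp j (prm j) (fun U => Real.exp κ * ρ j U)) ∧ (∃ κ : ℝ, MemAtHeight F ℰp j (prm j) (fun U => Real.exp κ * ρ' j U)) ∧ μ j {U | ¬ PlaqSmall (θBal F.L γ b₀ p₀ j) U} ≤ ENNReal.ofReal (η j) ∧ μ' j {U | ¬ PlaqSmall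 (θBal F.L γ b₀ p₀ j) U} ≤ ENNReal.ofReal (η j) ∧ (ContinuousOn (ρ j) {U | PlaqSmall (θBal F.L γ b₀ p₀ j) U} ∧ ContinuousOn (ρ' j) {U | PlaqSmall (θBal F.L γ b₀ p₀ j) U}) ∧ ((∀ (U : GaugeField _ _ ↥(Matrix.specialUnitaryGroup (Fin 2) ℂ)), PlaqSmall (49 / 50 * θBal F.L γ b₀ p₀ j) U → ∀ (b b' : PBond _ _) (v v' : Fin 3 → ℝ), ‖v‖ ≤ 1 → ‖v'‖ ≤ 1 → ∃ g : ℂ × ℂ → ℂ, DifferentiableOn ℂ g (Metric.ball (0 : ℂ) (rA * (49 / 50 * θBal F.L γ b₀ p₀ j)) ×ˢ Metric.ball (0 : ℂ) (rA * (49 / 50 * θBal F.L γ b₀ p₀ j))) ∧ (∀ (s t : ℝ) (V Z : GaugeField _ _ ↥(Matrix.specialUnitaryGroup (Fin 2) ℂ)), |s| < rA * (49 / 50 * θBal F.L γ b₀ p₀ j) → |t| < rA * (49 / 50 * θBal F.L γ b₀ p₀ j) → (∀ e, e ≠ b → V e = U e) → V b = U b * expPt (s • v) → (∀ e, e ≠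 b' → Z e = V e) → Z b' = V b' * expPt (t • v') → g ((s : ℂ), (t : ℂ)) = (((Real.log (ρ j Z)) : ℝ) : ℂ)) ∧ ∀ z ∈ Metric.ball (0 : ℂ) (rA * (49 / 50 * θBal F.L γ b₀ p₀ j)) ×ˢ Metric.ball (0 : ℂ) (rA * (49 / 50 * θBal F.L γ b₀ p₀ j)), ‖g z - g 0‖ ≤ (Bρ j)) ∧ (∀ (U : GaugeField _ _ ↥(Matrix.specialUnitaryGroup (Fin 2) ℂ)), PlaqSmall (49 / 50 * θBal F.L γ b₀ p₀ j) U → ∀ (b b' : PBond _ _) (v v' : Fin 3 → ℝ), ‖v‖ ≤ 1 → ‖v'‖ ≤ 1 → ∃ g : ℂ × ℂ → ℂ, DifferentiableOn ℂ g (Metric.ball (0 : ℂ) (rA * (49 / 50 * θBal F.L γ b₀ p₀ j)) ×ˢ Metric.ball (0 : ℂ) (rA * (49 / 50 * θBal F.L γ b₀ p₀ j))) ∧ (∀ (s t : ℝ) (V Z : GaugeField _ _ ↥(Matrix.specialUnitaryGroup (Fin 2) ℂ)), |s| < rA * (49 / 50 * θBal F.L γ b₀ p₀ j) → |t| < rA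 * (49 / 50 * θBal F.L γ b₀ p₀ j) → (∀ e, e ≠ b → V e = U e) → V b = U b * expPt (s • v) → (∀ e, e ≠ b' → Z e = V e) → Z b' = V b' * expPt (t • v') → g ((s : ℂ), (t : ℂ)) = (((Real.log (ρ' j Z)) : ℝ) : ℂ)) ∧ ∀ z ∈ Metric.ball (0 : ℂ) (rA * (49 / 50 * θBal F.L γ b₀ p₀ j)) ×ˢ Metric.ball (0 : ℂ) (rA * (49 / 50 * θBal F.L γ b₀ p₀ j)), ‖g z - g 0‖ ≤ (Bρ j))))) → ∀ (w : ℝ), 0 ≤ w → w / (((F.L : ℝ) ^ Ts / γ) * θBal F.L γ b₀ p₀ Ts ^ 2) ≤ w₀ → (∃ k : PBond (F.P Ts) 0 → PBond (F.P Ts) 0 → ℝ, (∀ b b', 0 ≤ k b b') ∧ (∀ b, ∑ b', k b b' * Real.exp (κ * (b.src.tdist b'.src : ℝ)) ≤ w) ∧ (∀ (b b' : PBond _ _) (v v' : Fin 3 → ℝ) (U V W Z : GaugeField _ _ ↥(Matrix.specialUnitaryGroup (Fin 2) ℂ)), ‖v‖ ≤ (rA / 2) * (θBal F.L γ b₀ p₀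 Ts / 4) → ‖v'‖ ≤ (rA / 2) * (θBal F.L γ b₀ p₀ Ts / 4) → PlaqSmall (θBal F.L γ b₀ p₀ Ts / 4) U → PlaqSmall (θBal F.L γ b₀ p₀ Ts / 4) V → PlaqSmall (θBal F.L γ b₀ p₀ Ts / 4) W → PlaqSmall (θBal F.L γ b₀ p₀ Ts / 4) Z → (∀ e, e ≠ b → V e = U e) → V b = U b * expPt v → (∀ e, e ≠ b' → W e = U e) → W b' = U b' * expPt v' → (∀ e, e ≠ b' → Z e = V e) → Z b' = V b' * expPt v' → |(Real.log (ρ Ts Z) - Real.log (ρ' Ts Z)) - (Real.log (ρ Ts V) - Real.log (ρ' Ts V)) - (Real.log (ρ Ts W) - Real.log (ρ' Ts W)) + (Real.log (ρ Ts U) - Real.log (ρ' Ts U))| ≤ k b b' * (‖v‖ / (θBal F.L γ b₀ p₀ Ts / 4)) * (‖v'‖ / (θBal F.L γ b₀ p₀ Ts / 4)))) → ∀ (j : ℕ), j₁ ≤ j → j + 1 ≤ Ts → ∃ (c' : Plaq (F.P j) 0 → ℝ) (a' w' : ℝ), 0 ≤ a' ∧ 0 ≤ w' ∧ a' + θ *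 (w' / (((F.L : ℝ) ^ j / γ) * θBal F.L γ b₀ p₀ j ^ 2)) ≤ (Ctr + εd (T - (Ts + 1)) + C * (w / (((F.L : ℝ) ^ Ts / γ) * θBal F.L γ b₀ p₀ Ts ^ 2))) * (w / (((F.L : ℝ) ^ Ts / γ) * θBal F.L γ b₀ p₀ Ts ^ 2)) + δ j ∧ (∀ p, |c' p| ≤ a') ∧ ∃ k' : PBond (F.P j) 0 → PBond (F.P j) 0 → ℝ, (∀ b b', 0 ≤ k' b b') ∧ (∀ b, ∑ b', k' b b' * Real.exp (κ * (b.src.tdist b'.src : ℝ)) ≤ w') ∧ (∀ (b b' : PBond _ _) (v v' : Fin 3 → ℝ) (U V W Z : GaugeField _ _ ↥(Matrix.specialUnitaryGroup (Fin 2) ℂ)), ‖v‖ ≤ r * (θBal F.L γ b₀ p₀ j / 4) → ‖v'‖ ≤ r * (θBal F.L γ b₀ p₀ j / 4) → PlaqSmall (θBal F.L γ b₀ p₀ j / 4) U → PlaqSmall (θBal F.L γ b₀ p₀ j / 4) V → PlaqSmall (θBal F.L γ b₀ p₀ j / 4) W → PlaqSmall (θBal F.L γ b₀ p₀ j / 4)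 Z → (∀ e, e ≠ b → V e = U e) → V b = U b * expPt v → (∀ e, e ≠ b' → W e = U e) → W b' = U b' * expPt v' → (∀ e, e ≠ b' → Z e = V e) → Z b' = V b' * expPt v' → |(Real.log (ρ j Z) - Real.log (ρ' j Z) - ((F.L : ℝ) ^ j / γ) * ∑ p, c' p * (1 - reTr (GaugeField.plaqHol Z p))) - (Real.log (ρ j V) - Real.log (ρ' j V) - ((F.L : ℝ) ^ j / γ) * ∑ p, c' p * (1 - reTr (GaugeField.plaqHol V p))) - (Real.log (ρ j W) - Real.log (ρ' j W) - ((F.L : ℝ) ^ j / γ) * ∑ p, c' p * (1 - reTr (GaugeField.plaqHol W p))) + (Real.log (ρ j U) - Real.log (ρ' j U) - ((F.L : ℝ) ^ j / γ) * ∑ p, c' p * (1 - reTr (GaugeField.plaqHol U p)))| ≤ k' b b' * (‖v‖ / (θBal F.L γ b₀ p₀ j / 4)) * (‖v'‖ / (θBal F.L γ b₀ p₀ j / 4))) :=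
  Summit.QuantumFields.YangMills.Theorems.OrganTangentOneStepTransportUHOfPolymerTransportH.oneStepTransportUH_of_polymerTransportH
    (polymerTransportH_of_tube hT)

end Summit.QuantumFields.YangMills.Theorems.OrganTangentOneStepTransportUHOfPolymerTransportHTube

end
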